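import Summits.BirchSwinnertonDyer.Uniform.UI.O6WildThreePartCore
import Summits.BirchSwinnertonDyer.Rank1Residual.SecondDescent.NonemptyCasselsTateFree
import Summits.BirchSwinnertonDyer.Rank1Residual.SecondDescent.ShaExponentFromNonDivisible
import Literature.NumberTheory.EllipticCurves.Rank1Residual.Typed.HigherDescentSelmerCertificate
import HarnessLib
import HarnessLib.Audit.Tags

/-!
# UI-O6 — the KERNEL READING of a second-`3`-descent record on a `#Ш_an = 81` row of pocket O6 (evidence item E-81)

Cell `bsd-uniform`, seat `ui-o6` (GEN 5, prover `prover-bsd-uniform-ui-o6-g5-0`); companion note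
`pub/bsd-uniform/ui/O6-CONJECTURE.md` §4.6e (evidence item E-81, pre-registration
`ui/evidence-o6/e81/PREREG-E81.md`: the b2b cell's frozen instrument B-1 = Creutz's second `3`-descent
`SEL3ALT-0.3` pressed byte-identically on the eleven irreducible rank-`0` O6 rows with `#Ш_an = 81`).

HONEST FRAMING. THEOREMS ONLY (no `def`, no named fact minted, no `sorry`; axioms standard). This file
proves NOTHING about any particular curve and nothing uniform about pocket O6. It states, once, in the
kernel, what ONE per-pair second-descent record means for the LEFT conjunct of the seat's typed
conjecture `Summit.BirchSwinnertonDyer.Uniform.UI.O6WildThreePart` (`MissingLowerBoundAt W 3` =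
`ord₃ #Ш_an ≤ ord₃ #Ш` on globally minimal analytic-rank-`0` `ClassO6 W 3` curves) on the rows where the
conjunct asks for MORE than a first `3`-descent can see (`ord₃ #Ш_an = 4`, while `dim Sel₃ = 2` certifies
`3²` only) — in both directions of the pre-registered read / kill rule — with the record's values as
EXPLICIT BINDERS. Every algebraic step is the b2b cell's (class-closure seat cc-eng-4,
`Rank1Residual/SecondDescent/`), REUSED BY NAME and never restated: the positive road is
`SecondDescent.missingLowerBoundAt_of_two_nonempty_selmer_rankZero` (two `NONEMPTY` witnesses ⇒ `3⁴ ∣ #Ш`,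
NO Cassels–Tate), the kill road is `WeierstrassCurve.sha_nsmul_eq_zero_of_sq_of_casselsTate_of_not_divisible`
(one `EMPTY` class + Cassels–Tate ⇒ `Ш[9] = Ш[3]`). What is NEW here is only the by-name bookkeeping for
the UI conjecture and the Tamagawa-exact `BSD(E,3)` consumer on wild rows. A record instantiating the
binders is PER-PAIR EVIDENCE, never a uniform theorem; nothing is booked; no census mark moves;
Gross–Zagier–Kolyvagin (`hGZK`), the Cassels–Tate pairing (`hCT`, kill road only), Kato's Thm. 14.5 (3)
read Tamagawa-exact (`hKatoT`) and modularity (`hmod`) enter as the tree's NAMED FACTS exactly as in the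
b2b consumers, so those theorems are CONDITIONAL on them.

CONTENTS.
* `missingPPartAt_three_of_two_nonempty_record_of_upper` — the record (analytic rank `0`,
  `#E(ℚ)[3] = 1`, two `𝔽₃`-independent Selmer elements whose `Ш`-classes are third multiples = the two
  `NONEMPTY(witness)` verdicts, `#Ш_an = q` with `ord₃ q ≤ 4`) gives the left conjunct's INSTANCE
  `MissingLowerBoundAt W 3` (b2b, by name) and, with the upper half where available, the full `3`-part
  output `MissingPPartAt W 3` at the pair.
* `bsdp_three_of_two_nonempty_record_of_katoTam` — **the wild consumer**: the same record on a
  tower-surjective analytic-rank-`0` `ClassX4 W 3` row with `ord₃ j ≥ 0` gives `BSDp W 3` from Kato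
  Thm. 14.5 (3) read TAMAGAWA-EXACT (`X4RankZero.bsdp_of_missingLowerBoundAt_of_katoTam`, b2b n1011-p14)
  + GZK + modularity — no `3 ∤ ∏ c_ℓ`, no Manin datum (unlike `X4RankZero.bsdp_three_of_kato_of_two_nonempty`),
  so it serves the E-81 row `422253b1` (`∏ c_ℓ = 3`) as well; and `bsdp_three_of_two_nonempty_record_of_katoTam_of_classO6`,
  the same keyed by the pocket predicate.
* `padicValNat_three_shaOrder_eq_two_of_empty_record` — **the kill road's value**: `Ш` finite, the
  Cassels–Tate fact, a complete first descent `#Sel₃ = 9` with `#E(ℚ)[3] = 1` at rank `0` (so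
  `#Ш[3] = 9`), and ONE class `c ∈ Ш[3]` that is NOT a third multiple (an `EMPTY` verdict) pin
  `ord₃ #Ш = 2` — the reading of the two negative-control rows of E-81 (`#Ш_an = 9`: E-CORE was sharp).
* `not_missingLowerBoundAt_three_of_empty_record` / `not_o6WildThreePart_of_empty_record` — **the kill
  reading (PREREG-E81 K81, kernel form)**: the same certificate on a row with `ord₃ #Ш_an > 2` refutes the
  lower half at the pair, hence — on a globally minimal analytic-rank-`0` O6 curve — the conjecture.
  Whatever the pre-registered run returns is tallied in the companion note §4.6e; the theorem records
  the falsifiability of the typed statement at the `3⁴` level and asserts nothing about any curve.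
-/

noncomputable section

open scoped Classical

open WeierstrassCurve Literature.NumberTheory.EllipticCurves
  Literature.NumberTheory.EllipticCurves.Rank1Residual
  Literature.NumberTheory.EllipticCurves.Rank1Residual.Typed
  Summit.BirchSwinnertonDyer.Rank1Residual.SecondDescent

namespace Summit.BirchSwinnertonDyer.Uniform.UI

open Summit.BirchSwinnertonDyer.Rank1Residual.Additive

variable (W : WeierstrassCurve ℚ) [W.IsElliptic]

/-! ### §1. The positive road: two `NONEMPTY` witnesses (b2b, by name) -/

/-- **Record + upper half ⇒ the full `3`-part output at the pair.** The E-81 record in Selmer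
currency — analytic rank `0` (rank `0` and `Ш` finite by `hGZK`), `#E(ℚ)[3] = 1`, two Selmer elements
`ξ₁, ξ₂` that are `𝔽₃`-independent (`hind0`), their classes `c₁, c₂ ∈ Ш` BOTH third multiples
(`hd₁`, `hd₂` = the two second-descent `NONEMPTY(witness)` verdicts, Creutz 2014 Thm. 7.2), and
`#Ш_an = q` with `ord₃ q ≤ 4` — gives the LOWER half `MissingLowerBoundAt W 3` by the b2b cell's
`SecondDescent.missingLowerBoundAt_of_two_nonempty_selmer_rankZero` (`3⁴ ∣ #Ш`, no Cassels–Tate); with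
the UPPER half `hup` (Kato Thm. 14.5 (3) where it applies) this is `MissingPPartAt W 3`. Per pair;
nothing booked. [cite: Creutz2014, §1 and Thm. 7.2] [cite: SilvermanAEC2009, Thm. X.4.2(a)]
[cite: Miller2011LMS, Def. 1.1 (arXiv:1010.2431 p. 3)] -/
theorem missingPPartAt_three_of_two_nonempty_record_of_upper
    (hGZK : rank_eq_analyticRank_of_analyticRank_le_one) (hr : W.analyticRank = 0)
    (htors : Nat.card (AddSubgroup.torsionBy W.toAffine.Point ((3 : ℕ) : ℤ)) = 1)
    {ξ₁ ξ₂ : W.galH1Torsion ((3 : ℕ) : ℤ)} (hξ₁ : ξ₁ ∈ W.selmerGroup ((3 : ℕ) : ℤ))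
    (hξ₂ : ξ₂ ∈ W.selmerGroup ((3 : ℕ) : ℤ))
    (hind0 : ∀ a b : ℤ, a • ξ₁ + b • ξ₂ = 0 → ((3 : ℕ) : ℤ) ∣ a ∧ ((3 : ℕ) : ℤ) ∣ b)
    {c₁ c₂ d₁ d₂ : W.sha} (hc₁ : (c₁ : W.galH1) = W.torsionH1ToH1 ((3 : ℕ) : ℤ) ξ₁)
    (hc₂ : (c₂ : W.galH1) = W.torsionH1ToH1 ((3 : ℕ) : ℤ) ξ₂) (hd₁ : (3 : ℕ) • d₁ = c₁)
    (hd₂ : (3 : ℕ) • d₂ = c₂) {q : ℚ} (hq : shaAn W = (q : ℂ)) (hv : padicValRat 3 q ≤ 4)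
    (hup : MissingUpperBoundAt W 3) : MissingPPartAt W 3 :=
  haveI : Fact (Nat.Prime 3) := ⟨Nat.prime_three⟩
  missingPPartAt_of_lower_of_upper W 3
    (missingLowerBoundAt_of_two_nonempty_selmer_rankZero W 3 hGZK hr htors hξ₁ hξ₂ hind0 hc₁ hc₂
      hd₁ hd₂ hq hv) hup

/-- **The wild consumer (Tamagawa-exact): `BSD(E,3)` on a tower-surjective analytic-rank-`0` X4 row
from the E-81 record.** Kato's Thm. 14.5 (3) read with the Tamagawa term (`hKatoT`, b2b n1011-p14:
`ord₃ #Ш + ord₃ ∏ c_ℓ ≤ ord₃(#Ш_an · ∏ c_ℓ)` on `X4 ∧ r_an = 0 ∧ ord₃ j ≥ 0 ∧ tower onto`) supplies the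
UPPER half with NO Tamagawa or Manin-constant price (`X4RankZero.bsdp_of_missingLowerBoundAt_of_katoTam`);
the record supplies the LOWER half (`SecondDescent.missingLowerBoundAt_of_two_nonempty_selmer_rankZero`).
Compared with the b2b consumer `X4RankZero.bsdp_three_of_kato_of_two_nonempty` the binders
`3 ∤ ∏ c_ℓ` and the parametrisation datum are GONE — so the E-81 row `422253b1` (`∏ c_ℓ = 3`) is served.
Conditional on the named facts; per pair; class X4 / pocket O6 unchanged; nothing booked.
[cite: Kato2004Asterisque, Thm. 14.5 (3) (p. 236), Prop. 14.16 (2) (p. 244)] [cite: Creutz2014, §1 and Thm. 7.2]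
[cite: Miller2011LMS, §1 and Def. 1.1] -/
theorem bsdp_three_of_two_nonempty_record_of_katoTam
    (hKatoT : Kato2004.rankZero_padicValNat_sha_add_padicValNat_tamagawa_le_of_additive_potGood_of_imageContainsSL2)
    (hGZK : rank_eq_analyticRank_of_analyticRank_le_one) (hmod : hasEntireLFunction_rat)
    [W.IsGloballyMinimal] (hr : W.analyticRank = 0) (hX : ClassX4 W 3) (hpot : 0 ≤ padicValRat 3 W.j)
    (hsurj : ∀ n : ℕ, W.HasSurjectiveModNGaloisRep (3 ^ n : ℕ))
    (htors : Nat.card (AddSubgroup.torsionBy W.toAffine.Point ((3 : ℕ) : ℤ)) = 1)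
    {ξ₁ ξ₂ : W.galH1Torsion ((3 : ℕ) : ℤ)} (hξ₁ : ξ₁ ∈ W.selmerGroup ((3 : ℕ) : ℤ))
    (hξ₂ : ξ₂ ∈ W.selmerGroup ((3 : ℕ) : ℤ))
    (hind0 : ∀ a b : ℤ, a • ξ₁ + b • ξ₂ = 0 → ((3 : ℕ) : ℤ) ∣ a ∧ ((3 : ℕ) : ℤ) ∣ b)
    {c₁ c₂ d₁ d₂ : W.sha} (hc₁ : (c₁ : W.galH1) = W.torsionH1ToH1 ((3 : ℕ) : ℤ) ξ₁)
    (hc₂ : (c₂ : W.galH1) = W.torsionH1ToH1 ((3 : ℕ) : ℤ) ξ₂) (hd₁ : (3 : ℕ) • d₁ = c₁)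
    (hd₂ : (3 : ℕ) • d₂ = c₂) {q : ℚ} (hq : shaAn W = (q : ℂ)) (hv : padicValRat 3 q ≤ 4) :
    BSDp W 3 :=
  haveI : Fact (Nat.Prime 3) := ⟨Nat.prime_three⟩
  X4RankZero.bsdp_of_missingLowerBoundAt_of_katoTam W 3 hKatoT hGZK hmod hr hX hpot hsurj
    (missingLowerBoundAt_of_two_nonempty_selmer_rankZero W 3 hGZK hr htors hξ₁ hξ₂ hind0 hc₁ hc₂
      hd₁ hd₂ hq hv)

/-- **The same keyed by the pocket predicate** (`ClassO6 W 3 = 3 ≠ 2 ∧ Addv ∧ SubW`; the X4 datum is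
`Addv ∧ Irr`, irreducibility from surjectivity mod `3` = the tower at `n = 1`; `ord₃ j ≥ 0` from `SubW`
by `ClassO6.padicValRat_j_nonneg`). This is the shape each E-81 target row instantiates: wild at `3`,
analytic rank `0`, `ρ̄_{E,3^n}` onto for all `n`, `#E(ℚ)[3] = 1`, the two witnesses, `#Ш_an = 81`.
Conditional on `hKatoT` / `hGZK` / `hmod`; per pair; nothing booked.
[cite: Kato2004Asterisque, Thm. 14.5 (3) (p. 236)] [cite: Creutz2014, §1 and Thm. 7.2] [cite: Miller2011LMS, Def. 1.1] -/
theorem bsdp_three_of_two_nonempty_record_of_katoTam_of_classO6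
    (hKatoT : Kato2004.rankZero_padicValNat_sha_add_padicValNat_tamagawa_le_of_additive_potGood_of_imageContainsSL2)
    (hGZK : rank_eq_analyticRank_of_analyticRank_le_one) (hmod : hasEntireLFunction_rat)
    [W.IsGloballyMinimal] (hr : W.analyticRank = 0) (hO6 : ClassO6 W 3)
    (hsurj : ∀ n : ℕ, W.HasSurjectiveModNGaloisRep (3 ^ n : ℕ))
    (htors : Nat.card (AddSubgroup.torsionBy W.toAffine.Point ((3 : ℕ) : ℤ)) = 1)
    {ξ₁ ξ₂ : W.galH1Torsion ((3 : ℕ) : ℤ)} (hξ₁ : ξ₁ ∈ W.selmerGroup ((3 : ℕ) : ℤ))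
    (hξ₂ : ξ₂ ∈ W.selmerGroup ((3 : ℕ) : ℤ))
    (hind0 : ∀ a b : ℤ, a • ξ₁ + b • ξ₂ = 0 → ((3 : ℕ) : ℤ) ∣ a ∧ ((3 : ℕ) : ℤ) ∣ b)
    {c₁ c₂ d₁ d₂ : W.sha} (hc₁ : (c₁ : W.galH1) = W.torsionH1ToH1 ((3 : ℕ) : ℤ) ξ₁)
    (hc₂ : (c₂ : W.galH1) = W.torsionH1ToH1 ((3 : ℕ) : ℤ) ξ₂) (hd₁ : (3 : ℕ) • d₁ = c₁)
    (hd₂ : (3 : ℕ) • d₂ = c₂) {q : ℚ} (hq : shaAn W = (q : ℂ)) (hv : padicValRat 3 q ≤ 4) :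
    BSDp W 3 := by
  haveI : Fact (Nat.Prime 3) := ⟨Nat.prime_three⟩
  haveI : NeZero ((3 : ℕ) : ℚ) := ⟨by norm_num⟩
  have h3 : W.HasSurjectiveModNGaloisRep ((3 : ℕ) : ℤ) := by
    have h := hsurj 1
    rwa [pow_one] at h
  have hirr : Irr W 3 := hasIrreducibleModPGaloisRep_of_hasSurjectiveModNGaloisRep W 3 h3
  exact bsdp_three_of_two_nonempty_record_of_katoTam W hKatoT hGZK hmod hr ⟨hO6.1, hO6.2.1, hirr⟩
    hO6.padicValRat_j_nonneg hsurj htors hξ₁ hξ₂ hind0 hc₁ hc₂ hd₁ hd₂ hq hv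

/-! ### §2. The kill road: one `EMPTY` class + Cassels–Tate (b2b, by name) -/

/-- **The value an `EMPTY` record pins: `ord₃ #Ш(E/ℚ) = 2`.** `Ш` finite; the Cassels–Tate pairing
fact `hCT`; a complete first `3`-descent `#Sel^{(3)}(E/ℚ) = 9` with `#E(ℚ)[3] = 1` at Mordell–Weil rank
`0` (so `#Ш[3] = 9`, `card_torsionBy_sha_eq_of_card_selmerGroup`); ONE class `c ∈ Ш`, `3 • c = 0`, that is
NOT a third multiple (`hndiv` = a second-descent `EMPTY` verdict for a cubic representing `c`). Then
`Ш[9] = Ш[3]` (`sha_nsmul_eq_zero_of_sq_of_casselsTate_of_not_divisible`, b2b) and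
`ord₃ #Ш = 2` (`padicValNat_shaOrder_eq_of_stable`). This is the kernel reading of E-81's two
negative-control rows (`#Ш_an = 9`): there the E-CORE lower bound was SHARP. Per pair; nothing booked.
[cite: SilvermanAEC2009, Thm. X.4.2(a) and Thm. X.4.14] [cite: Creutz2014, §1] -/
theorem padicValNat_three_shaOrder_eq_two_of_empty_record (hfin : W.ShaFinite)
    (hCT : exists_casselsTate_pairing (K := ℚ)) (hrank : W.mordellWeilRank = 0)
    (htors : Nat.card (AddSubgroup.torsionBy W.toAffine.Point (3 : ℕ)) = 1)
    (hSel : Nat.card (W.selmerGroup ((3 : ℕ) : ℤ)) = 3 ^ 2)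
    {c : W.sha} (h3c : (3 : ℕ) • c = 0) (hndiv : ∀ d : W.sha, (3 : ℕ) • d ≠ c) :
    padicValNat 3 W.shaOrder = 2 := by
  haveI : Fact (Nat.Prime 3) := ⟨Nat.prime_three⟩
  haveI : Finite W.sha := hfin
  have hinst : (instDecidableEqRat : DecidableEq ℚ) = fun a b => Classical.propDecidable (a = b) :=
    Subsingleton.elim _ _
  have htors' := htors
  rw [hinst] at htors'
  have hcard : Nat.card (AddSubgroup.torsionBy W.sha (3 : ℕ)) = 3 ^ 2 :=
    card_torsionBy_sha_eq_of_card_selmerGroup W 3 (a := 1) (c := 3 ^ 2)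
      (by rw [hrank, pow_zero, htors', one_mul]) Nat.one_pos (by rw [one_mul]; exact hSel)
  have hstab : ∀ x : W.sha, 3 ^ (1 + 1) • x = 0 → 3 ^ 1 • x = 0 := by
    intro x hx
    rw [pow_one]
    exact sha_nsmul_eq_zero_of_sq_of_casselsTate_of_not_divisible hCT W Nat.prime_three hcard h3c
      hndiv x hx
  exact padicValNat_shaOrder_eq_of_stable W 3 hfin hstab (k := 1) (m := 2) (by rw [pow_one]; exact hcard)

/-- **The kill reading (PREREG-E81 K81, kernel form).** With the certificate of
`padicValNat_three_shaOrder_eq_two_of_empty_record` on a curve whose analytic order of `Ш` is a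
rational `q` with `ord₃ q > 2`, the LOWER half FAILS at `(E, 3)`: `ord₃ #Ш = 2 < ord₃ #Ш_an`.
[cite: SilvermanAEC2009, Thm. X.4.14] [cite: Creutz2014, §1] [cite: Miller2011LMS, Def. 1.1] -/
theorem not_missingLowerBoundAt_three_of_empty_record (hfin : W.ShaFinite)
    (hCT : exists_casselsTate_pairing (K := ℚ)) (hrank : W.mordellWeilRank = 0)
    (htors : Nat.card (AddSubgroup.torsionBy W.toAffine.Point (3 : ℕ)) = 1)
    (hSel : Nat.card (W.selmerGroup ((3 : ℕ) : ℤ)) = 3 ^ 2)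
    {c : W.sha} (h3c : (3 : ℕ) • c = 0) (hndiv : ∀ d : W.sha, (3 : ℕ) • d ≠ c)
    {q : ℚ} (hq : shaAn W = (q : ℂ)) (hv : 2 < padicValRat 3 q) : ¬ MissingLowerBoundAt W 3 := by
  have hval := padicValNat_three_shaOrder_eq_two_of_empty_record W hfin hCT hrank htors hSel h3c hndiv
  rintro ⟨q', hq', hle⟩
  have hqq : q' = q := by exact_mod_cast hq'.symm.trans hq
  subst hqq
  rw [hval] at hle
  exact absurd (lt_of_lt_of_le hv hle) (lt_irrefl _)

/-- **What ONE surviving `EMPTY` record on a `#Ш_an = 81` target row would have meant.** A globally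
minimal elliptic `W/ℚ` of analytic rank `0` in pocket O6 (`ClassO6 W 3`) carrying a complete first
descent `#Sel^{(3)} = 9`, `#E(ℚ)[3] = 1`, ONE `3`-torsion class of `Ш` that is not a third multiple
(second-descent `EMPTY`, EXACT) while `ord₃ #Ш_an > 2` refutes `O6WildThreePart` (its left conjunct at
`W`; rank `0` and finiteness from `hGZK`; the Cassels–Tate fact `hCT`). This is PREREG-E81's kill
rule K81 in the kernel: the theorem records the falsifiability of the typed statement at the `3⁴`
level; whether any target row produces such a record is the run's business (companion note §4.6e),
not this file's — nothing about any curve is asserted here.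
[cite: Kato2004Asterisque, Conj. 12.10 (p. 224)] [cite: Creutz2014, §1] [cite: Miller2011LMS, Def. 1.1] -/
theorem not_o6WildThreePart_of_empty_record [W.IsGloballyMinimal]
    (hGZK : rank_eq_analyticRank_of_analyticRank_le_one) (hCT : exists_casselsTate_pairing (K := ℚ))
    (hr : W.analyticRank = 0) (hO6 : ClassO6 W 3)
    (htors : Nat.card (AddSubgroup.torsionBy W.toAffine.Point (3 : ℕ)) = 1)
    (hSel : Nat.card (W.selmerGroup ((3 : ℕ) : ℤ)) = 3 ^ 2)
    {c : W.sha} (h3c : (3 : ℕ) • c = 0) (hndiv : ∀ d : W.sha, (3 : ℕ) • d ≠ c)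
    {q : ℚ} (hq : shaAn W = (q : ℂ)) (hv : 2 < padicValRat 3 q) : ¬ O6WildThreePart := by
  intro h
  obtain ⟨hrank, hfin⟩ := hGZK W (by omega)
  rw [hr] at hrank
  exact not_missingLowerBoundAt_three_of_empty_record W hfin hCT hrank htors hSel h3c hndiv hq hv
    (h.1 W hr hO6)

end Summit.BirchSwinnertonDyer.Uniform.UI
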